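import Mathlib
import HarnessLib

/-!
# Generic tools for the window flux bound of the crux `EulerZoomLiouville.PowerGaugeEulerLiouville`
# (route №10 `EulerZoomLiouville`, item stmt-NavierStokesRegularity-19832; successor target #1 of the lead's
# line `birth`: «no Euler collapse from rest», unconditional in the upper part of the window)

Helper file (theorems only; `--supports stmt-NavierStokesRegularity-19832`). Seat ns-typeII-p3
(cell ns-regularity-ideate §B, D-0081). Route-independent real analysis (no `Theses` import):
* `lintegral_rpow_threeHalves_le` — Hölder in time: `∫_I h^{3/2} ≤ |I|^{1/4} (∫_I h²)^{3/4}`;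
* `lintegral_mul_le_threeHalves_three` — Hölder `∫ f g ≤ (∫ f^{3/2})^{2/3} (∫ g³)^{1/3}`;
* `inv_max_one_norm_le_tsum` — the flux weight is dominated by a geometric sum of indicators of dyadic
  balls: `1/max(1,|x|) ≤ Σ_k 2^{1−k} 1_{B(0,2^{k+1})}(x)`;
* `lintegral_weight_le_tsum` — hence `∫_{I×ℝ³} F/max(1,|x|) ≤ Σ_k 2^{1−k} ∫_{I×B(0,2^{k+1})} F` for every
  a.e.-measurable density `F ≥ 0` (no shells, no partition).
WHAT THIS IS NOT: not NS — measure theory only. [folklore]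
-/

noncomputable section

-- the summit and its single problem share the name `NavierStokesRegularity` (D-0017 nested layout)
set_option linter.dupNamespace false

open Set Function Filter Topology MeasureTheory Metric TopologicalSpace
open scoped NNReal ENNReal

namespace Summit.NavierStokesRegularity.NavierStokesRegularity.Theorems.PowerGaugeEulerLiouville.WindowFlux

/-! ## Hölder inequalities -/

/-- **Hölder in time with exponents `(4, 4/3)`**: for an a.e.-measurable `h ≥ 0` on a finite-measure space,
`∫ h^{3/2} ≤ μ(univ)^{1/4} (∫ h²)^{3/4}`. [folklore] -/
theorem lintegral_rpow_threeHalves_le {α : Type*} [MeasurableSpace α] (μ : Measure α) {h : α → ℝ≥0∞}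
    (hh : AEMeasurable h μ) :
    ∫⁻ t, h t ^ (3 / 2 : ℝ) ∂μ ≤ μ univ ^ (1 / 4 : ℝ) * (∫⁻ t, h t ^ (2 : ℝ) ∂μ) ^ (3 / 4 : ℝ) := by
  have hpq : Real.HolderConjugate 4 (4 / 3 : ℝ) := by
    rw [Real.holderConjugate_iff]
    norm_num
  have h1 := ENNReal.lintegral_mul_le_Lp_mul_Lq μ hpq (f := fun _ => (1 : ℝ≥0∞)) (g := fun t => h t ^ (3 / 2 : ℝ))
    aemeasurable_const (hh.pow_const _)
  simp only [Pi.mul_apply, one_mul, ENNReal.one_rpow, lintegral_const, one_div] at h1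
  have h2 : ∀ t, (h t ^ (3 / 2 : ℝ)) ^ (4 / 3 : ℝ) = h t ^ (2 : ℝ) := fun t => by
    rw [← ENNReal.rpow_mul]; norm_num
  simp_rw [h2] at h1
  norm_num at h1 ⊢
  exact h1

/-- **Hölder with exponents `(3/2, 3)`**: `∫ f g ≤ (∫ f^{3/2})^{2/3} (∫ g³)^{1/3}` for a.e.-measurable
`f, g ≥ 0`. [folklore] -/
theorem lintegral_mul_le_threeHalves_three {α : Type*} [MeasurableSpace α] (μ : Measure α) {f g : α → ℝ≥0∞}
    (hf : AEMeasurable f μ) (hg : AEMeasurable g μ) :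
    ∫⁻ t, f t * g t ∂μ ≤ (∫⁻ t, f t ^ (3 / 2 : ℝ) ∂μ) ^ (2 / 3 : ℝ) * (∫⁻ t, g t ^ (3 : ℝ) ∂μ) ^ (1 / 3 : ℝ) := by
  have hpq : Real.HolderConjugate (3 / 2 : ℝ) 3 := by
    rw [Real.holderConjugate_iff]
    norm_num
  have h1 := ENNReal.lintegral_mul_le_Lp_mul_Lq μ hpq hf hg
  simp only [Pi.mul_apply, one_div] at h1
  rw [show ((3 : ℝ) / 2)⁻¹ = 2 / 3 by norm_num] at h1
  rw [one_div]
  exact h1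

/-! ## The flux weight `1/max(1,|x|)` against dyadic balls -/

/-- **The flux weight is dominated by a geometric sum of dyadic-ball indicators**:
`1/max(1,|x|) ≤ Σ_{k≥0} 2·2^{−k}·1_{B(0,2^{k+1})}(x)` (one term suffices: `k = 0` if `|x| < 1`, else the `k`
with `2^k ≤ |x| < 2^{k+1}`). [folklore] -/
theorem inv_max_one_norm_le_tsum {E : Type*} [NormedAddCommGroup E] (x : E) :
    ENNReal.ofReal ((max 1 ‖x‖)⁻¹) ≤
      ∑' k : ℕ, (ball (0 : E) ((2 : ℝ) ^ (k + 1))).indicator (fun _ => (2 : ℝ≥0∞) * (2⁻¹ : ℝ≥0∞) ^ k) x := by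
  have hm : 1 ≤ max 1 ‖x‖ := le_max_left _ _
  -- choose the dyadic index of `x`
  obtain ⟨j, hjmem, hjle⟩ : ∃ j : ℕ, x ∈ ball (0 : E) ((2 : ℝ) ^ (j + 1)) ∧ (max 1 ‖x‖)⁻¹ ≤ 2 * (2⁻¹ : ℝ) ^ j := by
    by_cases hx : ‖x‖ < 1
    · refine ⟨0, mem_ball_zero_iff.2 (by norm_num; linarith), ?_⟩
      rw [max_eq_left hx.le]
      norm_num
    · push Not at hx
      obtain ⟨j, hj1, hj2⟩ := exists_nat_pow_near hx one_lt_two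
      refine ⟨j, mem_ball_zero_iff.2 hj2, ?_⟩
      rw [max_eq_right hx]
      have hpos : (0 : ℝ) < 2 ^ j := by positivity
      calc ‖x‖⁻¹ ≤ ((2 : ℝ) ^ j)⁻¹ := by
            rw [inv_le_inv₀ (by linarith) hpos]; exact hj1
        _ = (2⁻¹ : ℝ) ^ j := by rw [inv_pow]
        _ ≤ 2 * (2⁻¹ : ℝ) ^ j := by nlinarith [pow_pos (by norm_num : (0 : ℝ) < 2⁻¹) j]
  calc ENNReal.ofReal ((max 1 ‖x‖)⁻¹) ≤ ENNReal.ofReal (2 * (2⁻¹ : ℝ) ^ j) := ENNReal.ofReal_le_ofReal hjle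
    _ = (ball (0 : E) ((2 : ℝ) ^ (j + 1))).indicator (fun _ => (2 : ℝ≥0∞) * (2⁻¹ : ℝ≥0∞) ^ j) x := by
        rw [indicator_of_mem hjmem, ENNReal.ofReal_mul (by norm_num), ENNReal.ofReal_pow (by norm_num),
          ENNReal.ofReal_inv_of_pos (by norm_num)]
        norm_num
    _ ≤ ∑' k : ℕ, (ball (0 : E) ((2 : ℝ) ^ (k + 1))).indicator (fun _ => (2 : ℝ≥0∞) * (2⁻¹ : ℝ≥0∞) ^ k) x :=
        ENNReal.le_tsum j

/-- **Weighted space–time integrals against dyadic balls**: for an a.e.-measurable density `F ≥ 0` on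
`I × E`, `∫_{I×E} F(z)/max(1,|z.2|) ≤ Σ_k 2·2^{−k} ∫_{I×B(0,2^{k+1})} F`. [folklore] -/
theorem lintegral_weight_le_tsum {E : Type*} [NormedAddCommGroup E] [MeasurableSpace E] [BorelSpace E]
    {μ : Measure (ℝ × E)} {I : Set ℝ} {F : ℝ × E → ℝ≥0∞}
    (hF : AEMeasurable F (μ.restrict (I ×ˢ (univ : Set E)))) :
    ∫⁻ z in I ×ˢ (univ : Set E), F z * ENNReal.ofReal ((max 1 ‖z.2‖)⁻¹) ∂μ ≤
      ∑' k : ℕ, (2 : ℝ≥0∞) * (2⁻¹ : ℝ≥0∞) ^ k * ∫⁻ z in I ×ˢ ball (0 : E) ((2 : ℝ) ^ (k + 1)), F z ∂μ := by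
  -- pointwise domination, then `lintegral_tsum`
  have hpt : ∀ z : ℝ × E, F z * ENNReal.ofReal ((max 1 ‖z.2‖)⁻¹) ≤
      ∑' k : ℕ, F z * (ball (0 : E) ((2 : ℝ) ^ (k + 1))).indicator (fun _ => (2 : ℝ≥0∞) * (2⁻¹ : ℝ≥0∞) ^ k) z.2 := by
    intro z
    rw [ENNReal.tsum_mul_left]
    exact mul_le_mul' le_rfl (inv_max_one_norm_le_tsum z.2)
  have hmeas : ∀ k : ℕ, AEMeasurable (fun z : ℝ × E =>
      F z * (ball (0 : E) ((2 : ℝ) ^ (k + 1))).indicator (fun _ => (2 : ℝ≥0∞) * (2⁻¹ : ℝ≥0∞) ^ k) z.2)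
      (μ.restrict (I ×ˢ (univ : Set E))) := by
    intro k
    refine hF.mul ?_
    exact ((measurable_const.indicator measurableSet_ball).comp measurable_snd).aemeasurable
  calc ∫⁻ z in I ×ˢ (univ : Set E), F z * ENNReal.ofReal ((max 1 ‖z.2‖)⁻¹) ∂μ
      ≤ ∫⁻ z in I ×ˢ (univ : Set E), ∑' k : ℕ,
          F z * (ball (0 : E) ((2 : ℝ) ^ (k + 1))).indicator (fun _ => (2 : ℝ≥0∞) * (2⁻¹ : ℝ≥0∞) ^ k) z.2 ∂μ :=
        lintegral_mono hpt
    _ = ∑' k : ℕ, ∫⁻ z in I ×ˢ (univ : Set E),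
          F z * (ball (0 : E) ((2 : ℝ) ^ (k + 1))).indicator (fun _ => (2 : ℝ≥0∞) * (2⁻¹ : ℝ≥0∞) ^ k) z.2 ∂μ :=
        lintegral_tsum hmeas
    _ = ∑' k : ℕ, (2 : ℝ≥0∞) * (2⁻¹ : ℝ≥0∞) ^ k * ∫⁻ z in I ×ˢ ball (0 : E) ((2 : ℝ) ^ (k + 1)), F z ∂μ := by
        refine tsum_congr fun k => ?_
        -- `F · 1_{ball}(z.2) · c` integrates over `I × E` to `c · ∫_{I × ball} F`
        have hind : ∀ z : ℝ × E,
            F z * (ball (0 : E) ((2 : ℝ) ^ (k + 1))).indicator (fun _ => (2 : ℝ≥0∞) * (2⁻¹ : ℝ≥0∞) ^ k) z.2 =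
            ((univ : Set ℝ) ×ˢ ball (0 : E) ((2 : ℝ) ^ (k + 1))).indicator
              (fun z => (2 : ℝ≥0∞) * (2⁻¹ : ℝ≥0∞) ^ k * F z) z := by
          intro z
          by_cases hz : z.2 ∈ ball (0 : E) ((2 : ℝ) ^ (k + 1))
          · rw [indicator_of_mem hz, indicator_of_mem (mem_prod.2 ⟨mem_univ _, hz⟩), mul_comm]
          · rw [indicator_of_notMem hz, indicator_of_notMem (fun h => hz (mem_prod.1 h).2), mul_zero]
        simp_rw [hind]
        have hset : ((univ : Set ℝ) ×ˢ ball (0 : E) ((2 : ℝ) ^ (k + 1))) ∩ (I ×ˢ (univ : Set E)) =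
            I ×ˢ ball (0 : E) ((2 : ℝ) ^ (k + 1)) := by
          rw [Set.prod_inter_prod, univ_inter, inter_univ]
        rw [lintegral_indicator (MeasurableSet.univ.prod measurableSet_ball), Measure.restrict_restrict
          (MeasurableSet.univ.prod measurableSet_ball), hset, lintegral_const_mul' _ _ (by
            exact ENNReal.mul_ne_top (by norm_num) (ENNReal.pow_ne_top (by norm_num)))]

end Summit.NavierStokesRegularity.NavierStokesRegularity.Theorems.PowerGaugeEulerLiouville.WindowFlux

end
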